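import Literature.NumberTheory.Sieve.LinearEquationsInPrimesNormalForm
import Literature.NumberTheory.Sieve.LinearEquationsInPrimesEnvelopingSieveDomination
import HarnessLib

/-!
# Linear equations in primes: the §7 reduction and the transference, discharged (Green–Tao 2010)

Trunk T-SIEVE (`Literature/NumberTheory/Sieve`). Companion ("Proofs") file of
`LinearEquationsInPrimesNormalForm.lean`, discharging two of its named facts:

* `Literature.NumberTheory.Sieve.GreenTao2010_wTrickedProduct_of_gowersUniformity_holds` — the
  printed reduction "Thm. 5.2 from Thm. 7.2" (B. Green, T. Tao, *Linear equations in primes*,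
  Ann. of Math. 171 (2010), §7, "Proof of Main Theorem assuming Theorem 7.2": enlarge `N` by a
  factor `O(1)` so that `Ψ(K) ⊆ [N]^t`; with `D = D_{s,t,d,L}` from Prop. 7.1 and
  `C = max(C₁, C₀(D))`, pick a prime `N' ∈ [CN, 2CN]` by Bertrand's postulate; the functions
  `c · (Λ'_{bᵢ,W} - 1)` are dominated by the `D`-pseudorandom measure `ν` of Prop. 6.4; apply
  Thm. 7.2 and Prop. 7.1 and divide out the factors of `c`). That argument is formalised, relative
  to Props. 6.4 and 7.1, as
  `Literature.NumberTheory.Sieve.GreenTao2010_wTrickedProduct_of_gowersUniformity_of_props`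
  (`LinearEquationsInPrimesPseudorandom.lean`); Prop. 6.4 is the theorem
  `Literature.NumberTheory.Sieve.GreenTao2010_pseudorandomDomination_holds`
  (`LinearEquationsInPrimesEnvelopingSieveDomination.lean`, App. D) and Prop. 7.1 is the theorem
  `Literature.NumberTheory.Sieve.GreenTao2010_generalisedVonNeumann_holds`
  (`LinearEquationsInPrimesGvN.lean`, App. C); this file only assembles them.
* `Literature.NumberTheory.Sieve.GreenTao2010_transference_holds` — the transference
  "Thm. 7.2 for all `s ≥ 1` implies the Main Theorem for systems of finite complexity"
  (`LinearEquationsInPrimesTransference.lean`), from the three printed reductions §4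
  (`GreenTao2010_main_of_mainNormalForm_holds`, `…MainReduction.lean`), §5
  (`GreenTao2010_mainNormalForm_of_wTricked_holds`, `…WTrick.lean`) and §7 (this file), via the
  proved assembly `GreenTao2010_transference_of_reductions`.

Nothing is restated: both theorems have literally the type of the corresponding `def … : Prop`.
This file lives apart from `LinearEquationsInPrimesNormalForm.lean` only because the proofs of
Props. 6.4 and 7.1 import that file.

## References

* B. Green, T. Tao, *Linear equations in primes*, Ann. of Math. (2) 171 (2010), 1753–1850
  (arXiv:math/0606088): §7 ("Proof of Main Theorem assuming Theorem 7.2"), Prop. 6.4 (App. D),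
  Prop. 7.1 (App. C), and the reductions of §§4–5.
-/

namespace Literature.NumberTheory.Sieve

/-- **§7: Thm. 5.2 from Thm. 7.2, PROVED** (Green–Tao 2010, "Proof of Main Theorem assuming
Theorem 7.2": "Let `D = D_{s,t,d,L}` be the constant in Proposition 7.1, and set
`C := max(C₁, C₀(D))` … Applying Bertrand's postulate, we may select a prime `N'` such that
`CN ≤ N' ≤ 2CN`. Let `ν` be the `D`-pseudorandom measure given by Proposition 6.4. Then the
functions `fᵢ(n) := c · (Λ'_{bᵢ,W} - 1)` will be pointwise dominated in magnitude by `ν` …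
Applying Theorem 7.2 and Proposition 7.1, we obtain the desired estimate after dividing out the
factors of `c`."). The named fact `GreenTao2010_wTrickedProduct_of_gowersUniformity` is a theorem
of this tree: the printed argument (`GreenTao2010_wTrickedProduct_of_gowersUniformity_of_props`)
fed with Prop. 6.4 (`GreenTao2010_pseudorandomDomination_holds`) and Prop. 7.1
(`GreenTao2010_generalisedVonNeumann_holds`).
[cite: GreenTao2010, §7 (Proof of Main Theorem assuming Theorem 7.2), Prop. 6.4, Prop. 7.1] -/
theorem GreenTao2010_wTrickedProduct_of_gowersUniformity_holds :
    GreenTao2010_wTrickedProduct_of_gowersUniformity :=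
  GreenTao2010_wTrickedProduct_of_gowersUniformity_of_props GreenTao2010_pseudorandomDomination_holds
    GreenTao2010_generalisedVonNeumann_holds

/-- **The transference, PROVED** (Green–Tao 2010, §§4–7: the Gowers uniformity estimate Thm. 7.2
for all `s ≥ 1` implies the Main Theorem for systems of finite complexity). The named fact
`GreenTao2010_transference` of `LinearEquationsInPrimesTransference.lean` follows from the three
printed reductions, all proved in this tree — §4 (`GreenTao2010_main_of_mainNormalForm_holds`),
§5 (`GreenTao2010_mainNormalForm_of_wTricked_holds`) and §7
(`GreenTao2010_wTrickedProduct_of_gowersUniformity_holds`) — by the proved assembly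
`GreenTao2010_transference_of_reductions` (which also performs the reduction Thm. 5.2 ⇒ Thm. 5.1).
[cite: GreenTao2010, §§4–7 (Proof of the Main Theorem assuming Theorems 4.5, 5.1, 7.2)] -/
theorem GreenTao2010_transference_holds : GreenTao2010_transference :=
  GreenTao2010_transference_of_reductions GreenTao2010_main_of_mainNormalForm_holds
    GreenTao2010_mainNormalForm_of_wTricked_holds
    GreenTao2010_wTrickedProduct_of_gowersUniformity_holds

end Literature.NumberTheory.Sieve
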